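import Summits.Ventures.PercRepro.ProfileThreeNoSplitHall
import Summits.Ventures.PercRepro.C025ProfileGenHall
import Summits.Ventures.PercRepro.C025ProfileStagedLine3Thm

/-!
# THE HALL FORM `(H⁺_{3,4})` FOR EVERY FINITE MATROID (night-3 g12 + p10 g6, 2026-08-26)
p10's Hall reduction `hallIneq_three_of_simple_short_lines` (Theorem A in Hall form + the simple reduction) composed with
night-3's `hallIneq_three_four_line3` (Theorem L3 + the staged certificate's Hall form) and the empty / top levels
(`hallIneq_of_eRank_lt`, `hallIneq_top`): for every finite matroid and every family `𝒜` of rank-`3` sets,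
`Σ_{B ∈ 𝒜} ρ(E∖B)/4 ≤ #{S : ρ(S) = 4, S ⊇ some B ∈ 𝒜}` (C-033's row `(3,4)`).
-/
open scoped Matroid
namespace PercRepro
open Set Finset ThmH

variable {α : Type} [DecidableEq α]

/-- **THE HALL FORM OF THE ROW `(3,4)` FOR EVERY FINITE MATROID AND EVERY FAMILY OF RANK-`3` SETS.** -/
theorem hallIneq_three_four (M : Matroid α) [M.Finite] : Profile.HallIneq M 3 4 := by
  apply Cogirth.hallIneq_three_of_simple_short_lines (le_refl 4)
  intro N _ hs hlines
  have hRtop : N.eRank ≠ ⊤ := N.eRank_ne_top_iff.2 inferInstance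
  obtain ⟨R, hRe⟩ := ENat.ne_top_iff_exists.1 hRtop
  rcases Nat.lt_or_ge R 4 with hlt4 | hge4
  · apply hallIneq_of_eRank_lt
    rw [← hRe]; exact_mod_cast hlt4
  rcases Nat.lt_or_ge R 5 with hlt5 | hge5
  · have heq4 : R = 4 := by omega
    exact hallIneq_top (R := 4) (by rw [← hRe, heq4]) 3
  · have hR : (5 : ℕ∞) ≤ N.eRank := by rw [← hRe]; exact_mod_cast hge5
    have hsimple : ∀ X ⊆ gr N, X.card = 2 → Staged.rkN N X = 2 := by
      intro X hXg hX2
      have hind := hs X hXg (by rw [hX2])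
      have henc : (X : Set α).encard = 2 := by rw [Set.encard_coe_eq_coe_finsetCard, hX2]; rfl
      rw [Staged.rkN_eq_iff, hind.eRk_eq_encard, henc]; rfl
    have h3line : ∀ X ⊆ gr N, Staged.rkN N X ≤ 2 → X.card ≤ 3 := by
      intro X hXg hX
      rcases Nat.lt_or_ge (Staged.rkN N X) 2 with hlt | hge
      · have h1 := Staged.card_le_one_of_rkN_le_one hsimple hXg (by omega)
        omega
      · have h2 : Staged.rkN N X = 2 := by omega
        exact hlines X hXg h2
    exact Staged.hallIneq_three_four_line3 hsimple h3line hR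

end PercRepro
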